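import Summits.QuantumAdvantage.QuantumAdvantage.Theorems.CubicForrelationSignedExactSliceIsLiftDefs

/-!
# Stub `stub_anfEmitFP` of line `Sketch` (crux K2 `SignedExactSliceIsLift`, stmt-QuantumAdvantage-14830)

Emitting the canonical XOR-of-ANDs netlist is polynomial time: the mirror circuit `anfPC n mons` (format of
`ForrelationCircuitCode.lean`: `pcE = ⟨[gate codes], output wire⟩`, a gate `⟨truth table, [wire codes]⟩`, a wire
`tag · bin index`) is computed on codes from `⟨1ⁿ, raw list of raw lists of binary numerals⟩` by a string function
in `FP`. The proof is combinator plumbing in the typed algebra `CodeFP` [cite: AroraBarak2009, §1.3 (closure of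
polynomial time under composition and polynomially bounded loops)]: a wire `(b, i)` is the string `[b] ++ bin i`
(`strAppend`), the literal wires `litW` are two `ite`s on `natLt` tests over `rawGetD`/`natLength`, a gate is the
`pair` of a constant truth table and a `rawCons`/`rawSingleton` list of wires, the touch gates are a `map₀` over
`urange`, the monomial blocks a `map` with context `(n, mons)` over `urange ∘ ulength` followed by `flatten`
(`List.flatMap_def`), and the three segments are `rawAppend`ed and paired with the output wire. No definitions.
-/

set_option linter.dupNamespace false -- D-0017: single-problem summit ⇒ `QuantumAdvantage.QuantumAdvantage` by design

noncomputable section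

namespace Summit.QuantumAdvantage.QuantumAdvantage.Theorems.SignedExactSliceIsLift

open _root_.Computability Literature.Computability.Complexity Literature.Computability.Cryptography
  Literature.Computability.QuantumComplexity
open Literature.Computability.Complexity.CodeFP (strE unE natE bitE pairE rawE)
open Summit.QuantumAdvantage.QuantumAdvantage.Theses.CubicForrelation (NearExactIsExact SignedExactSliceIsLift)

namespace StubAnfEmitFP

open ForrCode Literature.Computability.Complexity.CodeFP

/-! ### Wires and gates on codes -/

/-- **Wire construction on codes**: `(b, i) ↦ (b, i)` from `⟨[b], bin i⟩` to the wire code `b · bin i`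
(concatenation of the two fields). [cite: AroraBarak2009, §1.3] -/
theorem mkWire_codeFP : CodeFP (pairE bitE natE) wireE (fun p => (p.1, p.2)) :=
  (strAppend.comp (((fst bitE natE).recodeOut (eγ := strE) (g' := fun p => [p.1]) fun _ => rfl).pair
    ((snd bitE natE).recodeOut (eγ := strE) (g' := fun p => natE p.2) fun _ => rfl))).recodeOut fun _ => rfl

/-- A gate wire `(true, k)` from a computed binary index. [cite: AroraBarak2009, §1.3] -/
theorem gateWire_codeFP {α : Type} {eα : α → List Bool} {k : α → ℕ} (hk : CodeFP eα natE k) :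
    CodeFP eα wireE (fun a => (true, k a)) :=
  mkWire_codeFP.comp ((const eα true).pair hk)

/-- **The literal wires on codes**: `((n, S), p) ↦ litW n S p` (arity, monomial and position in binary).
[cite: AroraBarak2009, §1.3] -/
theorem litW_codeFP : CodeFP (pairE (pairE natE (rawE natE)) natE) wireE (fun t => litW t.1.1 t.1.2 t.2) := by
  -- the code of a literal context `((n, S), p)`
  let LE : (ℕ × List ℕ) × ℕ → List Bool := pairE (pairE natE (rawE natE)) natE
  have hp : CodeFP LE natE (fun t => t.2) := snd _ _
  have hS : CodeFP LE (rawE natE) (fun t => t.1.2) := (fst _ _).snd'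
  have hn : CodeFP LE natE (fun t => t.1.1) := (fst _ _).fst'
  have hlen : CodeFP LE natE (fun t => t.1.2.length) := (natLength natE).comp hS
  have hget : CodeFP LE natE (fun t => t.1.2.getD t.2 0) := (rawGetD natE (d := 0) rfl).comp (hS.pair hp)
  have hc1 : CodeFP LE bitE (fun t => decide (t.2 < t.1.2.length)) := natLt.comp (hp.pair hlen)
  have hc2 : CodeFP LE bitE (fun t => decide (t.1.2.getD t.2 0 < t.1.1)) := natLt.comp (hget.pair hn)
  have hin : CodeFP LE wireE (fun t => ((false, t.1.2.getD t.2 0) : Wire)) :=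
    mkWire_codeFP.comp ((const LE false).pair hget)
  refine ((hc1.ite (hc2.ite hin (const LE ((true, 1) : Wire))) (const LE ((true, 0) : Wire))).congr
    fun t => ?_)
  simp only [litW, decide_eq_true_eq]

/-- **One monomial block on codes**: `((n, mons), m) ↦ blockGates n m (mons[m] or [])` (`n` unary, `mons` a raw
list of raw lists of binary numerals, `m` binary). [cite: AroraBarak2009, §1.3] -/
theorem blockGates_codeFP : CodeFP (pairE (pairE unE (rawE (rawE natE))) natE) (rawE pgE)
    (fun t => blockGates t.1.1 t.2 (t.1.2.getD t.2 [])) := by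
  -- the code of a block context `((n, mons), m)`
  let BE : (ℕ × List (List ℕ)) × ℕ → List Bool := pairE (pairE unE (rawE (rawE natE))) natE
  have hn : CodeFP BE natE (fun t => t.1.1) := natOfUn.comp (fst _ _).fst'
  have hm : CodeFP BE natE (fun t => t.2) := snd _ _
  have hS : CodeFP BE (rawE natE) (fun t => t.1.2.getD t.2 []) :=
    (rawGetD (rawE natE) (d := ([] : List ℕ)) rfl).comp ((fst _ _).snd'.pair hm)
  have hlit : ∀ p : ℕ, CodeFP BE wireE (fun t => litW t.1.1 (t.1.2.getD t.2 []) p) := fun p =>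
    litW_codeFP.comp ((hn.pair hS).pair (const BE p))
  have h3m : CodeFP BE natE (fun t => 3 * t.2) := natMul.comp ((const BE 3).pair hm)
  have hidx : ∀ c : ℕ, CodeFP BE natE (fun t => c + t.1.1 + 3 * t.2) := fun c =>
    natAdd.comp ((natAdd.comp ((const BE c).pair hn)).pair h3m)
  have hg1 : CodeFP BE pgE (fun t => (ttAnd, [litW t.1.1 (t.1.2.getD t.2 []) 0, litW t.1.1 (t.1.2.getD t.2 []) 1])) :=
    (const BE ttAnd).pair ((rawCons wireE).comp ((hlit 0).pair ((rawSingleton wireE).comp (hlit 1))))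
  have hg2 : CodeFP BE pgE
      (fun t => (ttAnd, [((true, 2 + t.1.1 + 3 * t.2) : Wire), litW t.1.1 (t.1.2.getD t.2 []) 2])) :=
    (const BE ttAnd).pair ((rawCons wireE).comp ((gateWire_codeFP (hidx 2)).pair
      ((rawSingleton wireE).comp (hlit 2))))
  have hg3 : CodeFP BE pgE
      (fun t => (ttXor, [((true, 1 + t.1.1 + 3 * t.2) : Wire), (true, 3 + t.1.1 + 3 * t.2)])) :=
    (const BE ttXor).pair ((rawCons wireE).comp ((gateWire_codeFP (hidx 1)).pair
      ((rawSingleton wireE).comp (gateWire_codeFP (hidx 3)))))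
  refine (((rawCons pgE).comp (hg1.pair ((rawCons pgE).comp (hg2.pair ((rawSingleton pgE).comp hg3))))).congr
    fun t => ?_)
  dsimp only [blockGates]

/-- **The touch gates on codes**: `j ↦ touchGate j` (`j` binary). [cite: AroraBarak2009, §1.3] -/
theorem touchGate_codeFP : CodeFP natE pgE touchGate := by
  have h1 : CodeFP natE wireE (fun j => ((true, 1 + j) : Wire)) :=
    gateWire_codeFP (natAdd.comp ((const natE 1).pair (CodeFP.id natE)))
  have h0 : CodeFP natE wireE (fun j => ((false, j) : Wire)) :=
    mkWire_codeFP.comp ((const natE false).pair (CodeFP.id natE))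
  exact ((const natE ttProj).pair ((rawCons wireE).comp (h1.pair ((rawSingleton wireE).comp h0)))).congr
    fun _ => rfl

/-- **The gate list on codes**: `(n, mons) ↦ anfGates n mons` (`n` unary, `mons` a raw list of raw lists of
binary numerals). [cite: AroraBarak2009, §1.3] -/
theorem anfGates_codeFP : CodeFP (pairE unE (rawE (rawE natE))) (rawE pgE) (fun p => anfGates p.1 p.2) := by
  -- the code of the input `(n, mons)`
  let IE : ℕ × List (List ℕ) → List Bool := pairE unE (rawE (rawE natE))
  have hconst : CodeFP IE (rawE pgE) (fun _ => [(ttTrue, ([] : List Wire)), (ttFalse, [])]) := const IE _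
  have htouch : CodeFP IE (rawE pgE) (fun p => (List.range p.1).map touchGate) :=
    (map₀ touchGate_codeFP).comp (urange.comp (fst _ _))
  have hm := CodeFP.map (σ := ℕ × List (List ℕ)) (eσ := IE) (eα := natE) (eβ := rawE pgE)
    (g := fun t => blockGates t.1.1 t.2 (t.1.2.getD t.2 [])) blockGates_codeFP
  have hblocks : CodeFP IE (rawE (rawE pgE))
      (fun p => (List.range p.2.length).map fun m => blockGates p.1 m (p.2.getD m [])) :=
    hm.comp ((CodeFP.id IE).pair (urange.comp ((ulength (rawE natE)).comp (snd _ _))))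
  have hflat := (flatten pgE).comp hblocks
  refine (((rawAppend pgE).comp (((rawAppend pgE).comp (hconst.pair htouch)).pair hflat)).congr fun p => ?_)
  rw [anfGates, List.flatMap_def]

/-- **The netlist on codes**: `(n, mons) ↦ anfPC n mons` (`n` unary, `mons` a raw list of raw lists of binary
numerals). [cite: AroraBarak2009, §1.3] -/
theorem anfPC_codeFP : CodeFP (pairE unE (rawE (rawE natE))) pcE (fun p => anfPC p.1 p.2) := by
  -- the code of the input `(n, mons)`
  let IE : ℕ × List (List ℕ) → List Bool := pairE unE (rawE (rawE natE))
  have hn : CodeFP IE natE (fun p => p.1) := natOfUn.comp (fst _ _)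
  have hlen : CodeFP IE natE (fun p => p.2.length) := (natLength (rawE natE)).comp (snd _ _)
  have hout : CodeFP IE wireE (fun p => ((true, 1 + p.1 + 3 * p.2.length) : Wire)) :=
    gateWire_codeFP (natAdd.comp ((natAdd.comp ((const IE 1).pair hn)).pair (natMul.comp ((const IE 3).pair hlen))))
  exact (anfGates_codeFP.pair hout).congr fun _ => rfl

end StubAnfEmitFP

/-- **Stub `stub_anfEmitFP`: emitting the canonical netlist is polynomial time.** The mirror circuit
`anfPC n mons` is computed on codes from `⟨1ⁿ, mons⟩` (`mons` a raw list of raw lists of binary numerals) by a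
string function in `FP`. [cite: AroraBarak2009, §1.3 (closure of polynomial time under composition and bounded loops)] -/
theorem stub_anfEmitFP : CodeFP (pairE unE (rawE (rawE natE))) ForrCode.pcE (fun p => anfPC p.1 p.2) :=
  StubAnfEmitFP.anfPC_codeFP

end Summit.QuantumAdvantage.QuantumAdvantage.Theorems.SignedExactSliceIsLift

end
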